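import Mathlib
import Literature.Analysis.FluidPDE.NormalisedPressureLpBoundNearOneClass
import Summits.NavierStokesRegularity.NavierStokesRegularity.Theorems.EulerZoomLiouvillePowerGaugeEulerLiouvillePressureBudgetNearFieldLog
import HarnessLib

/-!
# Crux `EulerZoomLiouville.PowerGaugeEulerLiouville` (stmt-NavierStokesRegularity-19832), nsreg-p2 ROUND-58 plate t60-ΠLOG:
# PIECE (1′) `NearFieldLog` — UNCONDITIONAL

Seat ns-ezl-w3 g9 (`--supports stmt-NavierStokesRegularity-19832 --as helper`).  The member: PIECE (1) on the class `C²_c`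
(`Literature.Analysis.FluidPDE.exists_eLpNorm_normalisedPressure_le_near_one_of_contDiff_two`, nsreg-typer g28 p719229 — Stein near `p = 1`
with the constant `C₀/(p−1)`) fed into `PressureSeam.nearFieldLog_of_steinBoundC2` (p719248) gives `NsregP2.R58b.NearFieldLog` VERBATIM
(`r58/Sketch58b.lean` sha16 16d8b95ef8e183bb §1 (1′); `E3` spelled out), with NO hypothesis:

* ★ `PressureSeam.nearFieldLog` — `∃ C > 0, ∀ R ≥ 1, ∀ w ∈ C²_c: p̃[w] ∈ L¹(B_R) ∧ ∫_{B_R}|p̃[w]| ≤ C·(∫|w|²)·(1 + log⁺(R²∫|∇w|²/∫|w|²))`;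
* `PressureSeam.nearFieldLog_of_steinNearOne` — the Sketch58b implication (1) ⇒ (1′) by name (the `C^∞_c` text of (1) is not even needed:
  the tree now carries (1) on `C²_c`).

HONEST FRAMING: instrument analysis about the normalised pressure of compactly supported fields; nothing about the crux E (19832 OPEN) or
NS regularity is proved; not E.  MODEL lattice only.
-/

noncomputable section

-- flat `Theorems/<Route><Decl>…` files of one crux share the namespace of the crux (tree convention)
set_option linter.dupNamespace false

open MeasureTheory Metric Filter Topology
open scoped ENNReal NNReal

namespace Summit.NavierStokesRegularity.NavierStokesRegularity.Theorems.PowerGaugeEulerLiouville.PressureSeam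

open Literature.Analysis.FluidPDE

/-- ★ **PIECE (1′) `NearFieldLog`, unconditional** (= `NsregP2.R58b.NearFieldLog` VERBATIM): the near-field `L¹` bound with the logarithm
for the normalised pressure of `C²` compactly supported fields.  [nsreg-p2 R58 `r58/Sketch58b.lean` §1 (1′); Stein 1970 Ch. II §6.2 (a) via
`exists_eLpNorm_normalisedPressure_le_near_one_of_contDiff_two`] -/
theorem nearFieldLog :
    ∃ C : ℝ, 0 < C ∧ ∀ R : ℝ, 1 ≤ R → ∀ w : EuclideanSpace ℝ (Fin 3) → EuclideanSpace ℝ (Fin 3),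
      ContDiff ℝ 2 w → HasCompactSupport w →
        IntegrableOn (normalisedPressure w) (ball (0 : EuclideanSpace ℝ (Fin 3)) R) volume ∧
        ∫ y in ball (0 : EuclideanSpace ℝ (Fin 3)) R, |normalisedPressure w y| ≤
          C * (∫ y, ‖w y‖ ^ 2) *
            (1 + Real.posLog (R ^ 2 * (∫ y, ‖fderiv ℝ w y‖ ^ 2) / ∫ y, ‖w y‖ ^ 2)) := by
  obtain ⟨C₀, hS⟩ := exists_eLpNorm_normalisedPressure_le_near_one_of_contDiff_two
  exact nearFieldLog_of_steinBoundC2 hS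

/-- The Sketch58b implication PIECE (1) ⇒ PIECE (1′) by name (`NsregP2.R58b.SteinNearOne → NsregP2.R58b.NearFieldLog`, both VERBATIM with
`E3` spelled out); the hypothesis is not used since (1′) is now unconditional. -/
theorem nearFieldLog_of_steinNearOne
    (_h : ∃ C₀ : ℝ≥0, ∀ p : ℝ≥0∞, 1 < p → p ≤ 2 →
      ∀ w : EuclideanSpace ℝ (Fin 3) → EuclideanSpace ℝ (Fin 3), ContDiff ℝ (⊤ : ℕ∞) w → HasCompactSupport w →
        eLpNorm (normalisedPressure w) p volume ≤
          (C₀ : ℝ≥0∞) / (p - 1) * eLpNorm (fun x => ‖w x‖ ^ 2) p volume) :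
    ∃ C : ℝ, 0 < C ∧ ∀ R : ℝ, 1 ≤ R → ∀ w : EuclideanSpace ℝ (Fin 3) → EuclideanSpace ℝ (Fin 3),
      ContDiff ℝ 2 w → HasCompactSupport w →
        IntegrableOn (normalisedPressure w) (ball (0 : EuclideanSpace ℝ (Fin 3)) R) volume ∧
        ∫ y in ball (0 : EuclideanSpace ℝ (Fin 3)) R, |normalisedPressure w y| ≤
          C * (∫ y, ‖w y‖ ^ 2) *
            (1 + Real.posLog (R ^ 2 * (∫ y, ‖fderiv ℝ w y‖ ^ 2) / ∫ y, ‖w y‖ ^ 2)) :=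
  nearFieldLog

end Summit.NavierStokesRegularity.NavierStokesRegularity.Theorems.PowerGaugeEulerLiouville.PressureSeam

end
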